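import Mathlib.Algebra.Lie.CartanCriterion
import Mathlib.Algebra.Lie.Weights.Linear
import Literature.NumberTheory.Automorphic.LieAlgebraGLJordan
import Literature.NumberTheory.Automorphic.LieAlgebraGLBracket
import Literature.NumberTheory.Automorphic.UnipotentNormalExp
import HarnessLib

/-!
# `𝔤^T = Lie(T)`: the maximal torus is its own infinitesimal centraliser in a reductive group
(trunk T-AUTOMORPHIC, G25 AutomorphicL; Springer, *Linear Algebraic Groups*, 5.4.7 with 7.6.4 (ii),
characteristic `0`)

Companion to `LieAlgebraGLJordan.lean` (Jordan decomposition inside `Lie(G)`, Springer 4.4.20),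
`LieAlgebraGLTorusHull.lean` (semisimple elements of `Lie(G)` commuting with a maximal torus `T` lie
in `Lie(T)`: Chevalley's algebraic hull), `LieAlgebraGLBracket.lean` (`Lie(G)` as a Lie
subalgebra of `𝔤𝔩ₙ`; `Lie(T)` centralises `𝔤^T`), `UnipotentNormalExp.lean` (reductive groups
contain no `Ad`-stable Lie algebra of nilpotent matrices) and `LieAlgebraWeights.lean`
(`𝔤 = 𝔤^T ⊕ ⨁_β 𝔤_β`), namespace `Literature.NumberTheory.Automorphic`. For `G ≤ GL n k`
connected reductive over an algebraically closed field of characteristic `0` and `T` a maximal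
torus, Springer proves `L(Z_G(T)) = 𝔷_𝔤(T)` (5.4.7) and `Z_G(T) = T` (7.6.4 (ii)) through the
theory of Borel subgroups; this file proves the Lie-algebra statement
**`lieWeightSpace_one_eq_lieAlgebraGL : 𝔤^T = Lie(T)`** (`𝔤^T = lieWeightSpace G T 1`, the
fixed points of `Ad(T)` in `Lie(G)`) by a route avoiding homogeneous spaces:

* `exists_jordan_of_mem_lieWeightSpace_one` — `X ∈ 𝔤^T` is `S + N` with `S ∈ Lie(T)` and
  `N ∈ 𝔤^T` nilpotent (Jordan parts are polynomials in `X`, hence commute with `T`);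
* `isNilpotent_centralizerLie` — `𝔤^T` is a nilpotent Lie algebra (`ad X = ad N`, Engel);
  `trace_mul_eq_zero_of_mem_lieWeightSpace_one` — `tr (N Y) = 0` for `N ∈ 𝔤^T` nilpotent and
  `Y ∈ 𝔤^T` (Mathlib `LieModule.traceForm_eq_sum_finrank_nsmul_mul` on the generalised weight
  spaces of `kⁿ`); with weight orthogonality (`trace_mul_eq_zero_of_mem_weightSpaceGL`) this gives
  `N ∈ 𝔨`, the radical of the trace form of `kⁿ` on `𝔤` (`traceRadical`,
  `trace_mul_eq_zero_of_mem_lieAlgebraGL`);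
* `𝔨` is an `Ad(G)`-stable Lie subalgebra (`lie_mem_traceRadical`, `conj_mem_traceRadical`); by
  **Cartan's criterion** (Mathlib `LieModule.isNilpotent_derivedSeries_of_traceForm_eq_zero`) its
  derived algebra acts nilpotently on `kⁿ` (`isNilpotent_of_mem_traceRadicalDerived`), so for
  reductive `G` it vanishes (`mul_comm_of_mem_traceRadical`, via
  `eq_bot_of_adStable_of_forall_isNilpotent`): `𝔨` is abelian; then its nilpotent elements form an
  `Ad(G)`-stable abelian Lie algebra of nilpotent matrices, again zero
  (`eq_zero_of_mem_traceRadical_of_isNilpotent`). Hence `N = 0` and `X = S ∈ Lie(T)`.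

Consumers (through `lieWeightSpace_one_le_lieAlgebraGL_of_charZero`; the named fact
`lieWeightSpace_one_le_lieAlgebraGL` of `RootSpaceDimension.lean` is its closed-`Prop` form):
`torus_sup_rootSubgroups_eq_of_lieWeights_subset` /
`IsSplitDual.isSplit_of_lieWeights_eq_roots` (`IsomorphismTheoremUniqueLie.lean`, hypothesis
`lieWeightSpace G T 1 ≤ lieAlgebraGL T`), `RootSpaceDimOne.lean`.

## Mathlib

`LieAlgebra.isNilpotent_iff_forall` (Engel), `LieAlgebra.isNilpotent_ad_of_isNilpotent`,
`LieModule.Weight.apply_eq_zero_of_isNilpotent`, `LieModule.traceForm_eq_sum_finrank_nsmul_mul`,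
`LieModule.isNilpotent_derivedSeries_of_traceForm_eq_zero` (Cartan), `LieAlgebra.derivedSeries`,
`LieModule.isNilpotent_toEnd_of_isNilpotent`, `Matrix.trace_toLin'_eq`. Mathlib has no algebraic
groups or tori; nothing here duplicates a Mathlib or Literature declaration (searched
`traceRadical`, `centralizerLie`, `lieWeightSpace_one`).

## References

* T. A. Springer, *Linear Algebraic Groups*, 2nd ed., Progress in Mathematics 9, Birkhäuser
  (1998), 4.4.20, 5.4.7, 7.6.4 (ii) [SpringerLAG1998].
* A. Borel, *Linear Algebraic Groups*, 2nd ed., GTM 126, Springer (1991), II §7, IV §§11–13.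
* N. Bourbaki, *Lie Groups and Lie Algebras*, Ch. I §5.4 (Cartan's criterion), §6.4.
-/

noncomputable section

/-! The commutator bracket on `Module.End k V` / `Matrix n n k` (Mathlib's reducible non-instance,
activated locally as in `Mathlib.Algebra.Lie.OfAssociative`). -/
attribute [local instance 100] LieRing.ofAssociativeRing

open MvPolynomial

namespace Literature.NumberTheory.Automorphic

variable {k : Type*} [Field k] {n : Type*} [Fintype n] [DecidableEq n]

/-! ### Traces and the standard Lie module of a Lie algebra of matrices -/

section Traces

omit [DecidableEq n] in
/-- `tr (A (B C)) = tr ((C A) B)`-type cyclicity in the form `tr ((A B - B A) Y) = tr (A (B Y - Y B))`.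
[folklore] -/
lemma trace_commutator_mul (A B Y : Matrix n n k) :
    Matrix.trace ((A * B - B * A) * Y) = Matrix.trace (A * (B * Y - Y * B)) := by
  rw [Matrix.sub_mul, Matrix.mul_sub, Matrix.trace_sub, Matrix.trace_sub, Matrix.mul_assoc,
    Matrix.mul_assoc, Matrix.trace_mul_comm B (A * Y), Matrix.mul_assoc]

variable {𝔫 : Submodule k (Matrix n n k)} {hlie : ∀ A ∈ 𝔫, ∀ B ∈ 𝔫, A * B - B * A ∈ 𝔫}

/-- In the standard module `kⁿ` of a Lie algebra `L ≤ End(kⁿ)`, `toEnd` is the inclusion. [folklore] -/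
lemma toEnd_endLieSubalgebra (x : ↥(endLieSubalgebra 𝔫 hlie)) :
    LieModule.toEnd k (↥(endLieSubalgebra 𝔫 hlie)) (n → k) x = (x : Module.End k (n → k)) := by
  rw [LieSubalgebra.toEnd_eq, LieModule.toEnd_module_end, LieHom.id_apply]

/-- The trace form of the standard module of `L = endLieSubalgebra 𝔫` on matrices:
`traceForm (toLin' A) (toLin' B) = tr (A B)`. [folklore] -/
lemma traceForm_endLieSubalgebra {A B : Matrix n n k} (hA : A ∈ 𝔫) (hB : B ∈ 𝔫) :
    LieModule.traceForm k (↥(endLieSubalgebra 𝔫 hlie)) (n → k)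
        ⟨Matrix.toLin' A, toLin'_mem_endLieSubalgebra hA⟩ ⟨Matrix.toLin' B, toLin'_mem_endLieSubalgebra hB⟩ =
      Matrix.trace (A * B) := by
  rw [LieModule.traceForm_apply_apply, toEnd_endLieSubalgebra, toEnd_endLieSubalgebra]
  change LinearMap.trace k (n → k) (Matrix.toLin' A ∘ₗ Matrix.toLin' B) = _
  rw [← Matrix.toLin'_mul, Matrix.trace_toLin'_eq]

end Traces

/-! ### The setting: `𝔪 = 𝔤^T`, its Jordan decomposition, its nilpotency -/

section Centralizer

variable [IsAlgClosed k] [CharZero k] {G T : Subgroup (GL n k)}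

/-- **Jordan decomposition inside `𝔪 = 𝔤^T`.** For `G` algebraic, `T` a maximal torus and
`X ∈ 𝔤^T = lieWeightSpace G T 1`: `X = S + N` with `S ∈ Lie(T)`, `N ∈ 𝔤^T` nilpotent, both
polynomials in `X`. (`exists_jordan_mem_lieAlgebraGL`, Springer 4.4.20; the semisimple part
commutes with `T` and so lies in `Lie(T)` by `mem_lieAlgebraGL_of_isMaximalTorusIn_of_isSemisimple`.)
[folklore] -/
theorem exists_jordan_of_mem_lieWeightSpace_one (hG : IsAlgebraicSubgroup G) (hT : IsMaximalTorusIn T G)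
    {X : Matrix n n k} (hX : X ∈ lieWeightSpace G T 1) :
    ∃ S N : Matrix n n k, X = S + N ∧ S ∈ lieAlgebraGL T ∧ N ∈ lieWeightSpace G T 1 ∧
      IsNilpotent N ∧ S ∈ Algebra.adjoin k {X} ∧ N ∈ Algebra.adjoin k {X} := by
  obtain ⟨S, N, hSG, hNG, hSs, hNn, hXSN, hSa, hNa⟩ := exists_jordan_mem_lieAlgebraGL hX.1
  have hXT : ∀ t ∈ T, Commute ((t : GL n k) : Matrix n n k) X := fun t ht =>
    mul_comm_of_mem_weightSpaceGL_one hX.2 ht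
  have hST : ∀ t ∈ T, (t : Matrix n n k) * S = S * (t : Matrix n n k) := fun t ht =>
    (Algebra.commute_of_mem_adjoin_singleton_of_commute hSa (hXT t ht)).eq
  have hNT : ∀ t ∈ T, (t : Matrix n n k) * N = N * (t : Matrix n n k) := fun t ht =>
    (Algebra.commute_of_mem_adjoin_singleton_of_commute hNa (hXT t ht)).eq
  refine ⟨S, N, hXSN, mem_lieAlgebraGL_of_isMaximalTorusIn_of_isSemisimple hG hT hSG hSs hST,
    ⟨hNG, fun t => ?_⟩, hNn, hSa, hNa⟩
  rw [MonoidHom.one_apply, Units.val_one, one_smul, hNT _ t.2, Matrix.mul_assoc,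
    Matrix.mul_nonsing_inv _ (Matrix.isUnits_det_units _), Matrix.mul_one]

variable (G T) in
/-- `𝔪 = 𝔤^T` as a Lie algebra of endomorphisms of `kⁿ` (`endLieSubalgebra`, bracket-closed by
`lie_mem_lieWeightSpace_one`). [folklore] -/
abbrev centralizerLie : LieSubalgebra k (Module.End k (n → k)) :=
  endLieSubalgebra (lieWeightSpace G T 1) fun _ hA _ hB => lie_mem_lieWeightSpace_one hA hB

/-- **`𝔪 = 𝔤^T` is a nilpotent Lie algebra** (for `G` algebraic and `T` a maximal torus, in
characteristic `0`): for `Y = S + N ∈ 𝔪` as in `exists_jordan_of_mem_lieWeightSpace_one`,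
`ad Y = ad N` on `𝔪` (`S ∈ Lie(T)` is central in `𝔪`, `lie_eq_zero_of_mem_lieAlgebraGL_of_mem_weightSpaceGL_one`)
and `ad N` is nilpotent (`LieAlgebra.isNilpotent_ad_of_isNilpotent`); conclude by Engel's theorem
(Mathlib `LieAlgebra.isNilpotent_iff_forall`). [folklore] -/
theorem isNilpotent_centralizerLie (hG : IsAlgebraicSubgroup G) (hT : IsMaximalTorusIn T G) :
    LieRing.IsNilpotent ↥(centralizerLie G T) := by
  haveI : IsMulCommutative ↥T := hT.2.1.2.1
  refine (LieAlgebra.isNilpotent_iff_forall (R := k)).2 fun y => ?_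
  obtain ⟨Y, hY, hYy⟩ := y.2
  obtain ⟨S, N, hYSN, hS, hN, hNn, -, -⟩ := exists_jordan_of_mem_lieWeightSpace_one hG hT hY
  have hSm : S ∈ lieWeightSpace G T 1 := lieAlgebraGL_le_lieWeightSpace_one hT.1 hS
  let s : ↥(centralizerLie G T) := ⟨Matrix.toLin' S, toLin'_mem_endLieSubalgebra hSm⟩
  let nn : ↥(centralizerLie G T) := ⟨Matrix.toLin' N, toLin'_mem_endLieSubalgebra hN⟩
  have hy : y = s + nn := by
    apply Subtype.ext
    change (y : Module.End k (n → k)) = Matrix.toLin' S + Matrix.toLin' N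
    rw [← hYy, ← map_add, ← hYSN]
    rfl
  -- `ad s = 0`
  have hs0 : LieAlgebra.ad k (↥(centralizerLie G T)) s = 0 := by
    refine LinearMap.ext fun z => ?_
    obtain ⟨Z, hZ, hZz⟩ := z.2
    rw [LieAlgebra.ad_apply, LinearMap.zero_apply]
    apply Subtype.ext
    rw [LieSubalgebra.coe_bracket, ZeroMemClass.coe_zero]
    change (s : Module.End k (n → k)) * (z : Module.End k (n → k)) - z * s = 0
    have hz' : (z : Module.End k (n → k)) = Matrix.toLin' Z := hZz.symm
    rw [hz']
    change Matrix.toLin' S * Matrix.toLin' Z - Matrix.toLin' Z * Matrix.toLin' S = 0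
    rw [Module.End.mul_eq_comp, Module.End.mul_eq_comp, ← Matrix.toLin'_mul, ← Matrix.toLin'_mul,
      ← map_sub, lie_eq_zero_of_mem_lieAlgebraGL_of_mem_weightSpaceGL_one hZ.2 hS, map_zero]
  have hnn : IsNilpotent (LieAlgebra.ad k (↥(centralizerLie G T)) nn) :=
    LieAlgebra.isNilpotent_ad_of_isNilpotent ((Matrix.isNilpotent_toLin'_iff N).2 hNn)
  rw [hy, map_add, hs0, zero_add]
  exact hnn

/-- **Nilpotent elements of `𝔪` are orthogonal to `𝔪` for the trace form of `kⁿ`**: for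
`N ∈ 𝔪` nilpotent and `Y ∈ 𝔪`, `tr (N Y) = 0`. Indeed `𝔪` is a nilpotent Lie algebra
(`isNilpotent_centralizerLie`), so on each generalised weight space of `kⁿ` its elements are
upper triangular with diagonal the weight (Mathlib `LieModule.traceForm_eq_sum_finrank_nsmul_mul`),
and every weight vanishes on the nilpotent `N` (`LieModule.Weight.apply_eq_zero_of_isNilpotent`).
[folklore] -/
theorem trace_mul_eq_zero_of_mem_lieWeightSpace_one (hG : IsAlgebraicSubgroup G)
    (hT : IsMaximalTorusIn T G) {N : Matrix n n k} (hN : N ∈ lieWeightSpace G T 1)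
    (hNn : IsNilpotent N) {Y : Matrix n n k} (hY : Y ∈ lieWeightSpace G T 1) :
    Matrix.trace (N * Y) = 0 := by
  haveI : LieRing.IsNilpotent ↥(centralizerLie G T) := isNilpotent_centralizerLie hG hT
  set nn : ↥(centralizerLie G T) := ⟨Matrix.toLin' N, toLin'_mem_endLieSubalgebra hN⟩ with hnn
  set y : ↥(centralizerLie G T) := ⟨Matrix.toLin' Y, toLin'_mem_endLieSubalgebra hY⟩ with hy
  have h := LieModule.traceForm_eq_sum_finrank_nsmul_mul (K := k) (L := ↥(centralizerLie G T))
    (M := n → k) nn y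
  have hχ : ∀ χ : LieModule.Weight k (↥(centralizerLie G T)) (n → k), χ nn = 0 := fun χ =>
    LieModule.Weight.apply_eq_zero_of_isNilpotent nn
      (by rw [toEnd_endLieSubalgebra]; exact (Matrix.isNilpotent_toLin'_iff N).2 hNn) χ
  simp only [hχ, zero_mul, smul_zero, Finset.sum_const_zero] at h
  rwa [traceForm_endLieSubalgebra hN hY] at h

omit [IsAlgClosed k] [CharZero k] in
/-- **Weight orthogonality**: for `N ∈ (𝔤𝔩ₙ)^T` and `Y` a weight vector of a non-trivial weight
`β` of `T`, `tr (N Y) = 0` (conjugating by `t ∈ T` with `β(t) ≠ 1` multiplies the trace by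
`β(t)`). [folklore] -/
theorem trace_mul_eq_zero_of_mem_weightSpaceGL {N : Matrix n n k} (hN : N ∈ weightSpaceGL T 1)
    {β : ↥T →* kˣ} (hβ : β ≠ 1) {Y : Matrix n n k} (hY : Y ∈ weightSpaceGL T β) :
    Matrix.trace (N * Y) = 0 := by
  obtain ⟨t, ht⟩ : ∃ t, β t ≠ 1 := by
    by_contra h
    push Not at h
    exact hβ (MonoidHom.ext h)
  have hNt : ((t : GL n k) : Matrix n n k) * N = N * ((t : GL n k) : Matrix n n k) :=
    mul_comm_of_mem_weightSpaceGL_one hN t.2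
  have h1 : Matrix.trace (((t : GL n k) : Matrix n n k) * (N * Y) * ((t : GL n k) : Matrix n n k)⁻¹) =
      Matrix.trace (N * Y) := by
    rw [Matrix.trace_mul_cycle, Matrix.nonsing_inv_mul _ (Matrix.isUnits_det_units _), Matrix.one_mul]
  have h2 : ((t : GL n k) : Matrix n n k) * (N * Y) * ((t : GL n k) : Matrix n n k)⁻¹ =
      N * (((t : GL n k) : Matrix n n k) * Y * ((t : GL n k) : Matrix n n k)⁻¹) := by
    rw [← Matrix.mul_assoc, hNt, Matrix.mul_assoc, Matrix.mul_assoc, Matrix.mul_assoc]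
  rw [h2, hY t, Matrix.mul_smul, Matrix.trace_smul, smul_eq_mul] at h1
  have h3 : (((β t : kˣ) : k) - 1) * Matrix.trace (N * Y) = 0 := by rw [sub_mul, one_mul, h1, sub_self]
  rcases mul_eq_zero.1 h3 with h4 | h4
  · exact absurd (Units.ext (sub_eq_zero.1 h4)) ht
  · exact h4

/-- Hence a nilpotent `N ∈ 𝔪` is orthogonal to all of `𝔤 = 𝔪 ⊕ ⨁_β 𝔤_β`
(`lieAlgebraGL_eq_sup_iSup_lieWeights`). [folklore] -/
theorem trace_mul_eq_zero_of_mem_lieAlgebraGL (hG : IsAlgebraicSubgroup G) (hT : IsMaximalTorusIn T G)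
    {N : Matrix n n k} (hN : N ∈ lieWeightSpace G T 1) (hNn : IsNilpotent N) {Y : Matrix n n k}
    (hY : Y ∈ lieAlgebraGL G) : Matrix.trace (N * Y) = 0 := by
  haveI : IsMulCommutative ↥T := hT.2.1.2.1
  let Z : Submodule k (Matrix n n k) :=
    LinearMap.ker (Matrix.traceLinearMap n k k ∘ₗ LinearMap.mulLeft k N)
  have hZ : ∀ Y, Y ∈ Z ↔ Matrix.trace (N * Y) = 0 := fun Y => by
    simp [Z]
  suffices h : lieAlgebraGL G ≤ Z from (hZ Y).1 (h hY)
  rw [lieAlgebraGL_eq_sup_iSup_lieWeights T hT.1 hT.2.1.2.2]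
  refine sup_le (fun Y hY => (hZ Y).2 (trace_mul_eq_zero_of_mem_lieWeightSpace_one hG hT hN hNn hY))
    (iSup₂_le fun β hβ Y hY => (hZ Y).2 ?_)
  exact trace_mul_eq_zero_of_mem_weightSpaceGL hN.2 (mem_lieWeights_iff.1 hβ).1 hY.2

end Centralizer

/-! ### The radical `𝔨` of the trace form on `𝔤` and Cartan's criterion -/

section TraceRadical

variable [IsAlgClosed k] [CharZero k] {G T : Subgroup (GL n k)}

variable (G) in
/-- The radical `𝔨 = {A ∈ 𝔤 | tr (A Y) = 0 for all Y ∈ 𝔤}` of the trace form of `kⁿ` on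
`𝔤 = Lie(G)`. [folklore] -/
def traceRadical : Submodule k (Matrix n n k) where
  carrier := {A | A ∈ lieAlgebraGL G ∧ ∀ Y ∈ lieAlgebraGL G, Matrix.trace (A * Y) = 0}
  zero_mem' := ⟨(lieAlgebraGL G).zero_mem, fun Y _ => by rw [Matrix.zero_mul, Matrix.trace_zero]⟩
  add_mem' := fun {A B} hA hB => ⟨(lieAlgebraGL G).add_mem hA.1 hB.1, fun Y hY => by
    rw [Matrix.add_mul, Matrix.trace_add, hA.2 Y hY, hB.2 Y hY, add_zero]⟩
  smul_mem' := fun c {A} hA => ⟨(lieAlgebraGL G).smul_mem c hA.1, fun Y hY => by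
    rw [Matrix.smul_mul, Matrix.trace_smul, hA.2 Y hY, smul_zero]⟩

omit [IsAlgClosed k] [CharZero k] in
/-- Membership in `𝔨`. [folklore] -/
lemma mem_traceRadical_iff {A : Matrix n n k} :
    A ∈ traceRadical G ↔ A ∈ lieAlgebraGL G ∧ ∀ Y ∈ lieAlgebraGL G, Matrix.trace (A * Y) = 0 :=
  Iff.rfl

omit [IsAlgClosed k] [CharZero k] in
/-- `𝔨 ≤ 𝔤`. [folklore] -/
lemma traceRadical_le : traceRadical G ≤ lieAlgebraGL G := fun _ hA => hA.1

omit [IsAlgClosed k] [CharZero k] in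
/-- `𝔨` is closed under the commutator (`tr ((A B - B A) Y) = tr (A (B Y - Y B))` with
`B Y - Y B ∈ 𝔤`). [folklore] -/
lemma lie_mem_traceRadical {A B : Matrix n n k} (hA : A ∈ traceRadical G) (hB : B ∈ traceRadical G) :
    A * B - B * A ∈ traceRadical G := by
  refine ⟨lie_mem_lieAlgebraGL hA.1 hB.1, fun Y hY => ?_⟩
  rw [trace_commutator_mul]
  exact hA.2 _ (lie_mem_lieAlgebraGL hB.1 hY)

omit [IsAlgClosed k] [CharZero k] in
/-- `𝔨` is `Ad(G)`-stable. [folklore] -/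
lemma conj_mem_traceRadical {g : GL n k} (hg : g ∈ G) {A : Matrix n n k} (hA : A ∈ traceRadical G) :
    (g : Matrix n n k) * A * ((g⁻¹ : GL n k) : Matrix n n k) ∈ traceRadical G := by
  refine ⟨conj_mem_lieAlgebraGL hg hA.1, fun Y hY => ?_⟩
  have hY' : ((g⁻¹ : GL n k) : Matrix n n k) * Y * (((g⁻¹)⁻¹ : GL n k) : Matrix n n k) ∈ lieAlgebraGL G :=
    conj_mem_lieAlgebraGL (G.inv_mem hg) hY
  rw [inv_inv] at hY'
  have h := hA.2 _ hY'
  have e : (g : Matrix n n k) * A * ((g⁻¹ : GL n k) : Matrix n n k) * Y =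
      (g : Matrix n n k) * (A * (((g⁻¹ : GL n k) : Matrix n n k) * Y * (g : Matrix n n k))) *
        ((g⁻¹ : GL n k) : Matrix n n k) := by
    simp only [Matrix.mul_assoc]
    rw [Units.mul_inv, Matrix.mul_one]
  rw [e, Matrix.trace_mul_cycle, Units.inv_mul, Matrix.one_mul, h]

end TraceRadical

/-! ### Cartan's criterion: `[𝔨, 𝔨]` acts nilpotently; reductivity kills it -/

section Cartan

variable [IsAlgClosed k] [CharZero k] {G T : Subgroup (GL n k)}

variable (G) in
/-- `𝔨` as a Lie algebra of endomorphisms of `kⁿ`. [folklore] -/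
abbrev traceRadicalLie : LieSubalgebra k (Module.End k (n → k)) :=
  endLieSubalgebra (traceRadical G) fun _ hA _ hB => lie_mem_traceRadical hA hB

omit [IsAlgClosed k] [CharZero k] in
/-- The trace form of `kⁿ` vanishes identically on `𝔨`. [folklore] -/
theorem traceForm_traceRadicalLie_eq_zero :
    LieModule.traceForm k (↥(traceRadicalLie G)) (n → k) = 0 := by
  refine LinearMap.ext fun a => LinearMap.ext fun b => ?_
  obtain ⟨A, hA, hAa⟩ := a.2
  obtain ⟨B, hB, hBb⟩ := b.2
  have ha : a = ⟨Matrix.toLin' A, toLin'_mem_endLieSubalgebra hA⟩ := Subtype.ext hAa.symm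
  have hb : b = ⟨Matrix.toLin' B, toLin'_mem_endLieSubalgebra hB⟩ := Subtype.ext hBb.symm
  rw [ha, hb, traceForm_endLieSubalgebra hA hB, LinearMap.zero_apply, LinearMap.zero_apply]
  exact hA.2 B hB.1

variable (G) in
/-- The span `[𝔨, 𝔨]` of the commutators of elements of `𝔨`. [folklore] -/
def traceRadicalDerived : Submodule k (Matrix n n k) :=
  Submodule.span k {C | ∃ A ∈ traceRadical G, ∃ B ∈ traceRadical G, C = A * B - B * A}

omit [IsAlgClosed k] [CharZero k] in
/-- `[𝔨, 𝔨] ≤ 𝔨`. [folklore] -/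
lemma traceRadicalDerived_le : traceRadicalDerived G ≤ traceRadical G := by
  refine Submodule.span_le.2 ?_
  rintro _ ⟨A, hA, B, hB, rfl⟩
  exact lie_mem_traceRadical hA hB

omit [IsAlgClosed k] in
/-- **Cartan's criterion for `𝔨`**: every element of `[𝔨, 𝔨]` is a nilpotent matrix. The trace
form of the faithful module `kⁿ` vanishes on `𝔨` (`traceForm_traceRadicalLie_eq_zero`), so by
Cartan's criterion (Mathlib `LieModule.isNilpotent_derivedSeries_of_traceForm_eq_zero`,
characteristic `0`) `kⁿ` is a nilpotent module for the derived algebra of `𝔨`, whose elements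
therefore act nilpotently. [folklore] -/
theorem isNilpotent_of_mem_traceRadicalDerived {C : Matrix n n k} (hC : C ∈ traceRadicalDerived G) :
    IsNilpotent C := by
  set K := traceRadicalLie G with hK
  set I := LieAlgebra.derivedSeries k (↥K) 1 with hI
  have hnil : LieModule.IsNilpotent (↥I) (n → k) :=
    LieModule.isNilpotent_derivedSeries_of_traceForm_eq_zero traceForm_traceRadicalLie_eq_zero
  -- `toLin' C` is an element of the derived algebra
  have hP : ∃ x : ↥K, x ∈ I ∧ (x : Module.End k (n → k)) = Matrix.toLin' C := by
    induction hC using Submodule.span_induction with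
    | mem C hC =>
      obtain ⟨A, hA, B, hB, rfl⟩ := hC
      let a : ↥K := ⟨Matrix.toLin' A, toLin'_mem_endLieSubalgebra hA⟩
      let b : ↥K := ⟨Matrix.toLin' B, toLin'_mem_endLieSubalgebra hB⟩
      refine ⟨⁅a, b⁆, ?_, ?_⟩
      · rw [hI, LieAlgebra.derivedSeries_def, LieAlgebra.derivedSeriesOfIdeal_succ,
          LieAlgebra.derivedSeriesOfIdeal_zero]
        exact LieSubmodule.lie_mem_lie (LieSubmodule.mem_top a) (LieSubmodule.mem_top b)
      · rw [LieSubalgebra.coe_bracket, map_sub, Matrix.toLin'_mul, Matrix.toLin'_mul]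
        rfl
    | zero => exact ⟨0, I.zero_mem, by rw [map_zero]; rfl⟩
    | add C C' _ _ hC hC' =>
      obtain ⟨x, hx, hxC⟩ := hC
      obtain ⟨x', hx', hxC'⟩ := hC'
      exact ⟨x + x', I.add_mem hx hx', by rw [map_add, ← hxC, ← hxC']; rfl⟩
    | smul c C _ hC =>
      obtain ⟨x, hx, hxC⟩ := hC
      exact ⟨c • x, I.smul_mem c hx, by rw [map_smul, ← hxC]; rfl⟩
  obtain ⟨x, hx, hxC⟩ := hP
  have h := LieModule.isNilpotent_toEnd_of_isNilpotent k (↥I) (n → k) ⟨x, hx⟩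
  have he : LieModule.toEnd k (↥I) (n → k) ⟨x, hx⟩ = Matrix.toLin' C := by
    refine LinearMap.ext fun v => ?_
    rw [LieModule.toEnd_apply_apply, LieIdeal.coe_bracket_of_module, LieSubalgebra.coe_bracket_of_module,
      Module.End.lie_apply]
    exact LinearMap.congr_fun hxC v
  rw [he] at h
  exact (Matrix.isNilpotent_toLin'_iff C).1 h

/-- **Reductivity kills `[𝔨, 𝔨]`**: for `G` reductive (characteristic `0`), `A B = B A` for all
`A, B ∈ 𝔨`. Indeed `[𝔨, 𝔨]` is an `Ad(G)`-stable, bracket-closed subspace of `Lie(G)` consisting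
of nilpotent matrices (`isNilpotent_of_mem_traceRadicalDerived`), hence zero by
`eq_bot_of_adStable_of_forall_isNilpotent`. [folklore] -/
theorem mul_comm_of_mem_traceRadical (hG : IsReductiveSubgroup G) {A B : Matrix n n k}
    (hA : A ∈ traceRadical G) (hB : B ∈ traceRadical G) : A * B = B * A := by
  have hD : traceRadicalDerived G = ⊥ := by
    refine eq_bot_of_adStable_of_forall_isNilpotent hG (traceRadicalDerived_le.trans traceRadical_le)
      ?_ ?_ (fun C hC => isNilpotent_of_mem_traceRadicalDerived hC)
    · intro g hg C hC
      induction hC using Submodule.span_induction with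
      | mem C hC =>
        obtain ⟨A, hA, B, hB, rfl⟩ := hC
        refine Submodule.subset_span ⟨_, conj_mem_traceRadical hg hA, _, conj_mem_traceRadical hg hB, ?_⟩
        have hgi : ((g⁻¹ : GL n k) : Matrix n n k) * (g : Matrix n n k) = 1 := Units.inv_mul g
        simp only [Matrix.mul_sub, Matrix.sub_mul, Matrix.mul_assoc]
        rw [← Matrix.mul_assoc ((g⁻¹ : GL n k) : Matrix n n k) (g : Matrix n n k), hgi, Matrix.one_mul,
          ← Matrix.mul_assoc ((g⁻¹ : GL n k) : Matrix n n k) (g : Matrix n n k), hgi, Matrix.one_mul]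
      | zero => rw [Matrix.mul_zero, Matrix.zero_mul]; exact Submodule.zero_mem _
      | add C C' _ _ hC hC' => rw [Matrix.mul_add, Matrix.add_mul]; exact Submodule.add_mem _ hC hC'
      | smul c C _ hC => rw [Matrix.mul_smul, Matrix.smul_mul]; exact Submodule.smul_mem _ c hC
    · intro C hC C' hC'
      exact Submodule.subset_span ⟨C, traceRadicalDerived_le hC, C', traceRadicalDerived_le hC', rfl⟩
  have h : A * B - B * A ∈ traceRadicalDerived G := Submodule.subset_span ⟨A, hA, B, hB, rfl⟩
  rw [hD, Submodule.mem_bot] at h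
  exact sub_eq_zero.1 h

omit [IsAlgClosed k] [CharZero k] in
/-- Conjugates of nilpotent matrices are nilpotent. [folklore] -/
lemma isNilpotent_conj {A : Matrix n n k} (hA : IsNilpotent A) (g : GL n k) :
    IsNilpotent ((g : Matrix n n k) * A * ((g⁻¹ : GL n k) : Matrix n n k)) := by
  obtain ⟨m, hm⟩ := hA
  refine ⟨m, ?_⟩
  have h : ∀ j : ℕ, ((g : Matrix n n k) * A * ((g⁻¹ : GL n k) : Matrix n n k)) ^ j =
      (g : Matrix n n k) * A ^ j * ((g⁻¹ : GL n k) : Matrix n n k) := by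
    intro j
    induction j with
    | zero => rw [pow_zero, pow_zero, Matrix.mul_one, Units.mul_inv]
    | succ j ih =>
      rw [pow_succ, ih, pow_succ]
      simp only [Matrix.mul_assoc]
      rw [← Matrix.mul_assoc ((g⁻¹ : GL n k) : Matrix n n k) (g : Matrix n n k), Units.inv_mul,
        Matrix.one_mul]
  rw [h, hm, Matrix.mul_zero, Matrix.zero_mul]

/-- **Reductivity kills the nilpotent elements of `𝔨`**: for `G` reductive (characteristic `0`),
a nilpotent `N ∈ 𝔨` vanishes. By `mul_comm_of_mem_traceRadical` the nilpotent elements of `𝔨`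
form an `Ad(G)`-stable, bracket-closed (abelian) subspace of `Lie(G)`, zero by
`eq_bot_of_adStable_of_forall_isNilpotent`. [folklore] -/
theorem eq_zero_of_mem_traceRadical_of_isNilpotent (hG : IsReductiveSubgroup G) {N : Matrix n n k}
    (hN : N ∈ traceRadical G) (hNn : IsNilpotent N) : N = 0 := by
  let 𝔨ₙ : Submodule k (Matrix n n k) :=
    { carrier := {A | A ∈ traceRadical G ∧ IsNilpotent A}
      zero_mem' := ⟨(traceRadical G).zero_mem, IsNilpotent.zero⟩
      add_mem' := fun {A B} hA hB => ⟨(traceRadical G).add_mem hA.1 hB.1,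
        Commute.isNilpotent_add (mul_comm_of_mem_traceRadical hG hA.1 hB.1) hA.2 hB.2⟩
      smul_mem' := fun c {A} hA => ⟨(traceRadical G).smul_mem c hA.1, hA.2.smul c⟩ }
  have h : 𝔨ₙ = ⊥ := by
    refine eq_bot_of_adStable_of_forall_isNilpotent hG (fun A hA => traceRadical_le hA.1) ?_ ?_
      (fun A hA => hA.2)
    · intro g hg A hA
      exact ⟨conj_mem_traceRadical hg hA.1, isNilpotent_conj hA.2 g⟩
    · intro A hA B hB
      rw [mul_comm_of_mem_traceRadical hG hA.1 hB.1, sub_self]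
      exact 𝔨ₙ.zero_mem
  have hN' : N ∈ 𝔨ₙ := ⟨hN, hNn⟩
  rw [h, Submodule.mem_bot] at hN'
  exact hN'

end Cartan

/-! ### The theorem -/

section Main

variable [IsAlgClosed k] [CharZero k] {G T : Subgroup (GL n k)}

/-- **`𝔤^T = Lie(T)`** (Springer, *Linear Algebraic Groups*, 5.4.7 with 7.6.4 (ii): for a
connected reductive `G` and a maximal torus `T`, `L(Z_G(T)) = 𝔷_𝔤(T) = 𝔤^T` and `Z_G(T) = T`;
here at the level of Lie algebras, over an algebraically closed field of characteristic `0`, by a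
route avoiding Borel subgroups and homogeneous spaces): the fixed points of `Ad(T)` in `Lie(G)`
are exactly `Lie(T)`. Proof: for `X ∈ 𝔤^T` write `X = S + N` (Jordan decomposition in `𝔤^T`,
`exists_jordan_of_mem_lieWeightSpace_one`: `S ∈ Lie(T)` by Chevalley's algebraic hull and the
maximality of `T`, `N ∈ 𝔤^T` nilpotent). Then `N` lies in the radical `𝔨` of the trace form of
`kⁿ` on `𝔤` (`trace_mul_eq_zero_of_mem_lieAlgebraGL`: Engel for the nilpotent Lie algebra `𝔤^T`
and weight orthogonality), and the nilpotent elements of `𝔨` vanish for reductive `G`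
(`eq_zero_of_mem_traceRadical_of_isNilpotent`: Cartan's criterion and the exponential). So
`X = S ∈ Lie(T)`. [cite: SpringerLAG1998, 5.4.7 and 7.6.4 (ii)] -/
theorem lieWeightSpace_one_eq_lieAlgebraGL (hG : IsConnectedReductive G) (hT : IsMaximalTorusIn T G) :
    lieWeightSpace G T 1 = lieAlgebraGL T := by
  haveI : IsMulCommutative ↥T := hT.2.1.2.1
  refine le_antisymm (fun X hX => ?_) (lieAlgebraGL_le_lieWeightSpace_one hT.1)
  obtain ⟨S, N, hXSN, hS, hN, hNn, -, -⟩ := exists_jordan_of_mem_lieWeightSpace_one hG.2.1 hT hX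
  have hNk : N ∈ traceRadical G :=
    ⟨hN.1, fun Y hY => trace_mul_eq_zero_of_mem_lieAlgebraGL hG.2.1 hT hN hNn hY⟩
  have hN0 : N = 0 := eq_zero_of_mem_traceRadical_of_isNilpotent hG.2 hNk hNn
  rw [hXSN, hN0, add_zero]
  exact hS

/-- The inclusion `𝔤^T ⊆ L(T)` in the form consumed by
`torus_sup_rootSubgroups_eq_of_lieWeights_subset` and `IsSplitDual.isSplit_of_lieWeights_eq_roots`
(`IsomorphismTheoremUniqueLie.lean`). In characteristic `0` this is the content of the named fact
`lieWeightSpace_one_le_lieAlgebraGL G T` of `RootSpaceDimension.lean` (a closed `Prop`, not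
imported here; its discharge from the present theorem is immediate). [cite: SpringerLAG1998, 5.4.7 and 7.6.4 (ii)] -/
theorem lieWeightSpace_one_le_lieAlgebraGL_of_charZero (hG : IsConnectedReductive G)
    (hT : IsMaximalTorusIn T G) : lieWeightSpace G T 1 ≤ lieAlgebraGL T :=
  (lieWeightSpace_one_eq_lieAlgebraGL hG hT).le

end Main

end Literature.NumberTheory.Automorphic
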